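import Mathlib
import Literature.MathematicalPhysics.QuantumFieldTheory.Balaban1983to89.B5Eq120IterProof

/-!
# `Balaban1983to89.B5AveragingOnto` — T. Bałaban, *Propagators and renormalization transformations for lattice gauge theories. I*,
Commun. Math. Phys. **95** (1984) 17–40 [Balaban1984PropagatorsI] ("B5" / [6I]), Sect. A pp. 19–20: the averaging operations `Q`
(1.11), `Q′` (1.13) and their iterates `Q_k` (1.18), `Q′_k` (1.20) of the V1 lattice calculus `LatticeFieldCalculus` map ONTO the
configurations of the coarse lattice (explicit right inverses), so that the renormalized objects indexed by «configurations B on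
the lattice T₁^{(k)}» (p. 26) — e.g. the fibres `{A : Q_kA = B}` of (1.16)/(1.47) — are non-empty for EVERY `B`

statement-level skeleton of published theorems with citation tags; proofs where landed; nothing here is a claim about the Yang–Mills mass gap

PDF held: `paper:balaban1984-cmp95-propagators-rt-i` (journal page = PDF page + 16; text layer pp. 18–20, 26 read).

CITATION HEADER (lean-in-tree rule).  Phase-2 proof seat p11 of the mega-formalization `lit-balaban` (HOME
`run/shared/lean/pub/lit-balaban/`), support file of SPARE row **C1.Eq4.4.1-4.4.3** (it removes the last displayed hypothesis
`B ∈ range Q_k` of the V1 Landau-gauge minimizer `BalabanImbrieJaffe1984to88.BIJ85LandauMinimizer442V1`).  THE PRINTED TEXT, verbatim.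
p. 19: *"(QA)_c = Σ_{x∈B(c₋)} L^{−(d+1)} A([x, x(c)]), (1.11)"*, *"(Q′λ)(y) = Σ_{x∈B(y)} L^{−d} λ(x). (1.13)"*; p. 20: *"(Q_kA)_b =
Σ_{x∈B^k(b₋)} η^{d+1} A([x, x(b)]) (1.18)"*, *"(Q′_kλ)(y) = Σ_{x∈B^k(y)} η^d λ(x). (1.20)"*; p. 26: *"It is defined on configurations B
on the lattice T₁^{(k)} and its value on such a configuration is equal to a configuration A on T_η minimizing the form ½⟨∂A, ∂A⟩
under the conditions Q_kA = B, R∂*A = 0."*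

WHAT IS TYPED AND PROVED HERE (real site functions / bond fields on the tori `T^{(j)}` of `Setup`, standing range `j + 1 ≤ m + K`).
`siteLift` (the block-constant extension `λ(x) = λ₁(y)`, `x ∈ B(y)`, of (1.15)) is a right inverse of `Q′` (`siteAvg_siteLift`);
`bondLift` (the bond field carrying `L·B(⟨y, μ⟩)` on the bonds `⟨x, x + e_μ⟩`, `x ∈ B(y)` on the far `μ`-face of the block, and `0`
elsewhere: every straight contour `[x, x(c)]` of (1.11) crosses that face exactly once) is a right inverse of `Q` (`bondAvg_bondLift`);
hence `Q′`, `Q`, `Q′_k`, `Q_k` (`k ≤ m + K`) are SURJECTIVE (`siteAvg_surjective`, `bondAvg_surjective`, `siteAvgIter_surjective`,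
`bondAvgIter_surjective`).  Carrier clauses (F6): the standing range of `Setup` (block structure `Site.blockOf_blockSite`).  Axioms:
the standard three.  Unit `lit-balaban-p11` (literature-prover-lit-balaban-p11-0).
-/

namespace Literature.MathematicalPhysics.QuantumFieldTheory.Balaban1983to89.B5AveragingOnto

open Literature.MathematicalPhysics.QuantumFieldTheory.Balaban1983to89.LatticeFieldCalculus

noncomputable section

variable {P : Params} {j : ℕ}

/-! ## `Q′` is onto: the block-constant extension (1.15) -/

/-- the block-constant extension of a coarse site function, *"λ(x) = λ₁(y) for x ∈ B(y)"* ((1.15) p. 19).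
[cite: Balaban1984PropagatorsI, (1.15) p.19] -/
def siteLift (g : SiteField P (j + 1) ℝ) : SiteField P j ℝ := fun x => g (blockOf x)

/-- unfolding `siteLift`. [cite: Balaban1984PropagatorsI, (1.15) p.19] -/
@[simp] theorem siteLift_apply (g : SiteField P (j + 1) ℝ) (x : Site P j) : siteLift g x = g (blockOf x) := rfl

/-- `Q′` of the block-constant extension of `λ₁` is `λ₁` ((1.13) reproduces block constants). [cite: Balaban1984PropagatorsI, (1.13) p.19] -/
theorem siteAvg_siteLift (hj : j + 1 ≤ P.m + P.K) (g : SiteField P (j + 1) ℝ) : siteAvg (siteLift g) = g := by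
  funext y
  have hL : (P.L : ℝ) ^ P.d ≠ 0 := pow_ne_zero _ (Nat.cast_ne_zero.mpr P.L_pos.ne')
  simp only [siteAvg, siteLift_apply, Site.blockOf_blockSite hj, Finset.sum_const, Finset.card_univ, Fintype.card_fun,
    Fintype.card_fin, smul_eq_mul, nsmul_eq_mul, Nat.cast_pow]
  rw [← mul_assoc, inv_mul_cancel₀ hL, one_mul]

/-- **`Q′` (1.13) is onto** the site functions of the coarse lattice. [cite: Balaban1984PropagatorsI, (1.13) p.19] -/
theorem siteAvg_surjective (hj : j + 1 ≤ P.m + P.K) :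
    Function.Surjective (siteAvg : SiteField P j ℝ → SiteField P (j + 1) ℝ) :=
  fun g => ⟨siteLift g, siteAvg_siteLift hj g⟩

/-- **`Q′_k` (1.20) is onto** (standing range `k ≤ m + K`). [cite: Balaban1984PropagatorsI, (1.20) p.20] -/
theorem siteAvgIter_surjective : ∀ {k : ℕ}, k ≤ P.m + P.K →
    Function.Surjective (siteAvgIter k : SiteField P 0 ℝ → SiteField P k ℝ)
  | 0, _ => fun g => ⟨g, rfl⟩
  | k + 1, hk => fun g => by
    obtain ⟨g₁, h₁⟩ := siteAvg_surjective hk g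
    obtain ⟨g₀, h₀⟩ := siteAvgIter_surjective (Nat.le_of_succ_le hk) g₁
    exact ⟨g₀, by rw [B5Eq120IterProof.siteAvgIter_succ, h₀, h₁]⟩

/-! ## `Q` is onto: the far-face lift -/

/-- the far-face lift of a coarse bond field `B`: the fine bond `⟨x, x + e_μ⟩` carries `L·B(⟨y, μ⟩)`, `y` the block of `x`, if `x`
lies on the far `μ`-face of its block (`x_μ ≡ L − 1 (mod L)`), and `0` otherwise — every straight contour `[x, x(c)]` of (1.11)
crosses the far face of `B(c₋)` exactly once. [cite: Balaban1984PropagatorsI, (1.11) p.19] -/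
def bondLift (B : VecField P (j + 1) ℝ) : VecField P j ℝ :=
  fun b => if (b.src b.dir).val % P.L = P.L - 1 then (P.L : ℝ) * B ⟨blockOf b.src, b.dir⟩ else 0

/-- the `μ`-coordinate along the straight contour from `blockSite y r`. [folklore] -/
private theorem runSite_blockSite_apply_self (y : Site P (j + 1)) (r : Fin P.d → Fin P.L) (μ : Fin P.d) (t : ℕ) :
    (runSite (Site.blockSite y r) μ t) μ = (((y μ).val * P.L + r μ + t : ℕ) : ZMod (P.sitesPerDir j)) := by
  simp only [runSite, Function.update_self, Site.blockSite]
  push_cast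
  ring

/-- the transverse coordinates along a straight contour do not move. [folklore] -/
private theorem runSite_apply_of_ne (x : Site P j) {μ ν : Fin P.d} (h : ν ≠ μ) (t : ℕ) : (runSite x μ t) ν = x ν := by
  simp only [runSite, Function.update_of_ne h]

/-- labels mod `L` can be read before reduction mod `N_j = N_{j+1}·L`. [folklore] -/
private theorem val_natCast_mod_L (hj : j + 1 ≤ P.m + P.K) (n : ℕ) : ((n : ZMod (P.sitesPerDir j))).val % P.L = n % P.L := by
  have hdvd : P.L ∣ P.sitesPerDir j := ⟨P.sitesPerDir (j + 1), by rw [P.sitesPerDir_eq_mul_succ hj, mul_comm]⟩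
  rw [ZMod.val_natCast, Nat.mod_mod_of_dvd _ hdvd]

/-- on the straight contour from `blockSite y r` in direction `μ`, the far `μ`-face is met at the step `t = L − 1 − r_μ` only.
[folklore] -/
private theorem face_iff (hj : j + 1 ≤ P.m + P.K) (y : Site P (j + 1)) (r : Fin P.d → Fin P.L) (μ : Fin P.d) {t : ℕ}
    (ht : t < P.L) : ((runSite (Site.blockSite y r) μ t) μ).val % P.L = P.L - 1 ↔ (r μ : ℕ) + t = P.L - 1 := by
  rw [runSite_blockSite_apply_self, val_natCast_mod_L hj,
    show (y μ).val * P.L + r μ + t = ((r μ : ℕ) + t) + (y μ).val * P.L by ring, Nat.add_mul_mod_self_right]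
  have hr := (r μ).isLt
  constructor
  · intro h
    rcases lt_or_ge ((r μ : ℕ) + t) P.L with hlt | hge
    · rwa [Nat.mod_eq_of_lt hlt] at h
    · exfalso
      rw [Nat.mod_eq_sub_mod hge, Nat.mod_eq_of_lt (by omega)] at h
      omega
  · intro h
    rw [h]
    exact Nat.mod_eq_of_lt (by omega)

/-- at that step the contour site is the block site with offset `L − 1` in direction `μ` (same block). [folklore] -/
private theorem runSite_blockSite_face (y : Site P (j + 1)) (r : Fin P.d → Fin P.L) (μ : Fin P.d) {t : ℕ}
    (h : (r μ : ℕ) + t = P.L - 1) :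
    runSite (Site.blockSite y r) μ t = Site.blockSite y (Function.update r μ ⟨P.L - 1, Nat.sub_lt P.L_pos Nat.one_pos⟩) := by
  funext ν
  by_cases hν : ν = μ
  · subst hν
    rw [runSite_blockSite_apply_self]
    simp only [Site.blockSite, Function.update_self]
    rw [add_assoc, h]
  · rw [runSite_apply_of_ne _ hν]
    simp only [Site.blockSite, Function.update_of_ne hν]

/-- the lift on the `t`-th bond of the straight contour `[x, x(c)]`, `x = blockSite c₋ r`. [folklore] -/
private theorem bondLift_runBond (hj : j + 1 ≤ P.m + P.K) (B : VecField P (j + 1) ℝ) (c : PBond P (j + 1))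
    (r : Fin P.d → Fin P.L) {t : ℕ} (ht : t < P.L) :
    bondLift B (runBond (Site.blockSite c.src r) c.dir t) = if (r c.dir : ℕ) + t = P.L - 1 then (P.L : ℝ) * B c else 0 := by
  unfold bondLift runBond
  simp only [face_iff hj c.src r c.dir ht]
  by_cases h : (r c.dir : ℕ) + t = P.L - 1
  · rw [if_pos h, if_pos h, runSite_blockSite_face c.src r c.dir h, Site.blockOf_blockSite hj]
  · rw [if_neg h, if_neg h]

/-- the contour sum of the lift: `(bondLift B)([x, x(c)]) = L·B(c)` for every `x ∈ B(c₋)`. [folklore] -/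
private theorem segSum_bondLift (hj : j + 1 ≤ P.m + P.K) (B : VecField P (j + 1) ℝ) (c : PBond P (j + 1))
    (r : Fin P.d → Fin P.L) : segSum (bondLift B) (Site.blockSite c.src r) c.dir P.L = (P.L : ℝ) * B c := by
  have hr := (r c.dir).isLt
  unfold segSum
  rw [Finset.sum_eq_single_of_mem (P.L - 1 - (r c.dir : ℕ)) (Finset.mem_range.mpr (by omega))]
  · rw [bondLift_runBond hj B c r (by omega), if_pos (by omega)]
  · intro t ht hne
    rw [bondLift_runBond hj B c r (Finset.mem_range.mp ht), if_neg (by omega)]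

/-- `Q` of the far-face lift of `B` is `B`: `L^{−(d+1)}·L^d·L·B(c) = B(c)`. [cite: Balaban1984PropagatorsI, (1.11) p.19] -/
theorem bondAvg_bondLift (hj : j + 1 ≤ P.m + P.K) (B : VecField P (j + 1) ℝ) : bondAvg (bondLift B) = B := by
  funext c
  have hL : (P.L : ℝ) ≠ 0 := Nat.cast_ne_zero.mpr P.L_pos.ne'
  simp only [bondAvg, segSum_bondLift hj, Finset.sum_const, Finset.card_univ, Fintype.card_fun, Fintype.card_fin,
    smul_eq_mul, nsmul_eq_mul, Nat.cast_pow]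
  rw [pow_succ]
  field_simp

/-- **`Q` (1.11) is onto** the bond fields of the coarse lattice. [cite: Balaban1984PropagatorsI, (1.11) p.19] -/
theorem bondAvg_surjective (hj : j + 1 ≤ P.m + P.K) :
    Function.Surjective (bondAvg : VecField P j ℝ → VecField P (j + 1) ℝ) :=
  fun B => ⟨bondLift B, bondAvg_bondLift hj B⟩

/-- **`Q_k` (1.18) is onto** (standing range `k ≤ m + K`): every configuration `B` on `T₁^{(k)}` is a k-fold average, so the
constraint `Q_kA = B` of (1.16)/(1.47) is satisfiable for every `B`. [cite: Balaban1984PropagatorsI, (1.18) p.20] -/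
theorem bondAvgIter_surjective : ∀ {k : ℕ}, k ≤ P.m + P.K →
    Function.Surjective (bondAvgIter k : VecField P 0 ℝ → VecField P k ℝ)
  | 0, _ => fun B => ⟨B, rfl⟩
  | k + 1, hk => fun B => by
    obtain ⟨B₁, h₁⟩ := bondAvg_surjective hk B
    obtain ⟨A, h₀⟩ := bondAvgIter_surjective (Nat.le_of_succ_le hk) B₁
    exact ⟨A, by rw [B5Eq120IterProof.bondAvgIter_succ, h₀, h₁]⟩

end

end Literature.MathematicalPhysics.QuantumFieldTheory.Balaban1983to89.B5AveragingOnto
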